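import Summits.Ventures.YMGap.Thresholds.LatticeBakryEmeryConvolution

/-!
# C²-density of polynomials on `SU(N)^ι` in Hessian currency (D1 of cell ym-beyond / seat P4, lens Y2)

TREE-SHAPED LIFT FILE (cell `ym-beyond`, HUMAN RULINGS D-0035 / D-0037; written by seat ym-beyond-p4 g8, which has NO filing
rights; filed by the cell's literature seat ym-beyond-lit g3 as part 3 of 3 — parts 1–2 are `LatticeBakryEmeryPolarisation`
(§1 currency items) and `LatticeBakryEmeryConvolution` (§2 A–D), split off to meet the 400-line rule; HOME sha16 dc5fd6e06aaf8b9f).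
Imports only landed tree files; farm `lean check` rc 0, 0 sorry.  Source: `HOME/ROUTE-P4Y2-Sketch.lean` v6 §5 (`algD_algD_smul_dir`), §5b (polarisation: `offDiagHessBound_of_hessBoundOn`, hypothesis unfolded),
§4e (the convolution proof) — verbatim, re-namespaced.  LANDING NOTE: every decl is `tree.orphan` until wired to an obligation (`--supports <item>`
of the YMGap venture, or cited by a route item); no `def … : Prop` here, so no `tree.vendored-fact`.

MAIN THEOREM. `c2PolyApprox_of_contDiff` (= the cell sketch's `ContDiff ℝ ∞ S → C2PolyApprox S`, conclusion spelled out; this file declares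
no `Prop`, so nothing to relocate) — for every smooth ambient `S : Cfg ι N → ℝ` and every
`ε > 0` there is a polynomial `p ∈ polySpace ι N dS` in the link entries with `|p − S| ≤ ε` on `SU(N)^ι`, `HessBound (p − S) ε` and
`OffDiagHessBound (p − S) (fun _ _ => ε)`.  MECHANISM: group convolution with POLYNOMIAL APPROXIMATE IDENTITIES
(`exists_poly_approxIdentity`, from the tree's Stone–Weierstrass `polyAlg_separatesPoints` + Urysohn), `polyConv k S := Q ↦ ∫ k(Q·emb h) S(emb h⁻¹) dHaar`
is a polynomial (`polyConv_mem`), right-flow covariance from LEFT Haar invariance gives `D_V D_V (k ⋆ S)(emb x) = ∫ k(emb(xh)) D_V D_V S(emb h⁻¹)`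
(`algD_algD_polyConv`), a tube lemma over the compact set of unit directions + the kernel estimate give `HessBound (p − S) ε`, and polarisation
(`offDiagHessBound_of_hessBoundOn`, commuting single-link derivatives) gives the off-diagonal profile.
USE: with the cell's approximation theorem (`ROUTE-P4Y2-Sketch.lean` §4d `cov_decay_quasilocal_of_approx`) this makes the tree's polynomial-only
clustering chain (`SharpClustering.covariance_le`, `cov_exp_decay_of_distFun`) cover EVERY SMOOTH action with the same constants.
References: Peter–Weyl density of representative functions (D. Applebaum, Probability on Compact Lie Groups (2014) Thm 2.2.4; Bröcker–tom Dieck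
III §3); the C² upgrade by convolution is textbook harmonic analysis. [folklore]
-/

noncomputable section

open scoped Matrix ComplexConjugate BigOperators Matrix.Norms.Frobenius ContDiff Topology
open Matrix Complex Finset MeasureTheory Filter
open Literature.MathematicalPhysics.QuantumFieldTheory
open Literature.MathematicalPhysics.QuantumFieldTheory.SUNBakryEmery (SUN FrameIdx frame expSU coe_expSU coordFn coordMat CoordIdx
  coordFn_true coordFn_false re_trace_mul_eq_sum)

namespace Summit.Ventures.YMGap

namespace LatticeBakryEmery

open Summit.Ventures.YMGap.SharpClustering

universe u

variable {ι : Type u} [Fintype ι] [DecidableEq ι] {N : ℕ}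

/-! #### E. Compactness: unit directions, joint continuity of the Hessian functional, the tube lemma -/


variable (ι N) in
/-- The unit directions of `𝔰𝔲(N)^ι` (sup-norm ball): a compact parameter set for the homogeneity reduction. -/
private def dirSet : Set (Cfg ι N) := {V | (∀ e, (V e)ᴴ = -V e) ∧ (∀ e, (V e).trace = 0) ∧ ‖V‖ ≤ 1}

omit [DecidableEq ι] in
/-- `dirSet` is compact (closed and bounded in a finite-dimensional space). [folklore] -/
theorem isCompact_dirSet : IsCompact (dirSet ι N) := by
  refine Metric.isCompact_of_isClosed_isBounded ?_ ?_
  · have h1 : IsClosed {V : Cfg ι N | ∀ e, (V e)ᴴ = -V e} := by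
      rw [Set.setOf_forall]
      exact isClosed_iInter fun e =>
        isClosed_eq (continuous_apply e).matrix_conjTranspose (continuous_apply e).neg
    have h2 : IsClosed {V : Cfg ι N | ∀ e, (V e).trace = 0} := by
      rw [Set.setOf_forall]
      exact isClosed_iInter fun e => isClosed_eq (continuous_apply e).matrix_trace continuous_const
    have h3 : IsClosed {V : Cfg ι N | ‖V‖ ≤ 1} := isClosed_le continuous_norm continuous_const
    have h : dirSet ι N = {V : Cfg ι N | ∀ e, (V e)ᴴ = -V e} ∩ ({V | ∀ e, (V e).trace = 0} ∩ {V | ‖V‖ ≤ 1}) := rfl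
    rw [h]
    exact h1.inter (h2.inter h3)
  · refine (Metric.isBounded_closedBall (x := (0 : Cfg ι N)) (r := 1)).subset fun V hV => ?_
    rw [Metric.mem_closedBall, dist_zero_right]
    exact hV.2.2

omit [DecidableEq ι] in
/-- `‖V‖_∞² ≤ Σ_e ‖V_e‖_F²`. [folklore] -/
theorem norm_sq_le_sum_frobNorm_sq (V : Cfg ι N) : ‖V‖ ^ 2 ≤ ∑ e, frobNorm (V e) ^ 2 := by
  have hs : 0 ≤ ∑ e, frobNorm (V e) ^ 2 := sum_nonneg fun e _ => sq_nonneg _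
  have h : ‖V‖ ≤ Real.sqrt (∑ e, frobNorm (V e) ^ 2) := by
    refine (pi_norm_le_iff_of_nonneg (Real.sqrt_nonneg _)).2 fun e => ?_
    have h1 : ‖V e‖ ^ 2 ≤ ∑ e', frobNorm (V e') ^ 2 := by
      rw [← frobNorm_eq_norm]
      exact single_le_sum (f := fun e' => frobNorm (V e') ^ 2) (fun e' _ => sq_nonneg _) (mem_univ e)
    exact (le_abs_self _).trans (Real.abs_le_sqrt h1)
  calc ‖V‖ ^ 2 ≤ Real.sqrt (∑ e, frobNorm (V e) ^ 2) ^ 2 := pow_le_pow_left₀ (norm_nonneg _) h 2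
    _ = ∑ e, frobNorm (V e) ^ 2 := Real.sq_sqrt hs

section GeneralAlgebra
variable {𝔸 : Type*} [NormedRing 𝔸] [NormedAlgebra ℝ 𝔸]

/-- **Joint continuity of the Hessian functional** `(V, Q) ↦ D_V D_V S (Q)` for smooth `S` (stated over a general
complete normed `ℝ`-algebra, like the tree's `algD` calculus, so that the operator-norm instances chain from
`NormedRing 𝔸`). [folklore] -/
theorem continuous_algD_algD {S : 𝔸 → ℝ} (hS : ContDiff ℝ ∞ S) :
    Continuous fun p : 𝔸 × 𝔸 => algD p.1 (algD p.1 S) p.2 := by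
  have h1 : ContDiff ℝ ∞ (fderiv ℝ S) := hS.fderiv_right (m := ∞) le_rfl
  have h2 : ContDiff ℝ ∞ (fderiv ℝ (fderiv ℝ S)) := h1.fderiv_right (m := ∞) le_rfl
  have key : ∀ V Q : 𝔸, algD V (algD V S) Q =
      fderiv ℝ (fderiv ℝ S) Q (Q * V) (Q * V) + fderiv ℝ S Q (Q * V * V) := by
    intro V Q
    have hd1 : DifferentiableAt ℝ (fderiv ℝ S) Q := h1.differentiable (by simp) Q
    have hu : DifferentiableAt ℝ (fun Q : 𝔸 => Q * V) Q := (hasFDerivAt_mul_const V Q).differentiableAt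
    unfold algD
    rw [fderiv_clm_apply hd1 hu]
    simp only [_root_.add_apply, ContinuousLinearMap.comp_apply, ContinuousLinearMap.flip_apply]
    rw [(hasFDerivAt_mul_const V Q).fderiv]
    simp only [ContinuousLinearMap.mulLeftRight_apply, one_mul]
    rw [add_comm]
  simp_rw [key]
  refine Continuous.add ?_ ?_
  · exact ((h2.continuous.comp continuous_snd).clm_apply (continuous_snd.mul continuous_fst)).clm_apply
      (continuous_snd.mul continuous_fst)
  · exact (h1.continuous.comp continuous_snd).clm_apply ((continuous_snd.mul continuous_fst).mul continuous_fst)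

end GeneralAlgebra

omit [Fintype ι] [DecidableEq ι] in
/-- Uniform bound for a jointly continuous family over a compact parameter set. [folklore] -/
theorem exists_bound_uniform {T : Set (Cfg ι N)} (hT : IsCompact T) {Φ : Cfg ι N → PSU ι N → ℝ}
    (hΦ : Continuous fun p : Cfg ι N × PSU ι N => Φ p.1 p.2) :
    ∃ M : ℝ, 0 ≤ M ∧ ∀ V ∈ T, ∀ g : PSU ι N, |Φ V g| ≤ M := by
  obtain ⟨C, hC⟩ := (hT.prod isCompact_univ).exists_bound_of_continuousOn hΦ.continuousOn
  refine ⟨max C 0, le_max_right _ _, fun V hV g => ?_⟩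
  have h := hC (V, g) ⟨hV, Set.mem_univ _⟩
  rw [Real.norm_eq_abs] at h
  exact h.trans (le_max_left _ _)

omit [Fintype ι] [DecidableEq ι] in
/-- **Tube lemma (uniform equicontinuity at the identity)**: for a jointly continuous family `Φ_V`, `V` in a
compact set, there is an open neighbourhood `U ∋ 1` with `|Φ_V(h⁻¹) − Φ_V(x)| < ε` whenever `x h ∈ U`. [folklore] -/
theorem exists_open_nhds_one_uniform {T : Set (Cfg ι N)} (hT : IsCompact T) {Φ : Cfg ι N → PSU ι N → ℝ}
    (hΦ : Continuous fun p : Cfg ι N × PSU ι N => Φ p.1 p.2) {ε : ℝ} (hε : 0 < ε) :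
    ∃ U : Set (PSU ι N), IsOpen U ∧ (1 : PSU ι N) ∈ U ∧
      ∀ V ∈ T, ∀ x h : PSU ι N, x * h ∈ U → |Φ V h⁻¹ - Φ V x| < ε := by
  set Θ : Cfg ι N × (PSU ι N × PSU ι N) → ℝ := fun z => |Φ z.1 z.2.2⁻¹ - Φ z.1 z.2.1| with hΘ
  have hΘc : Continuous Θ :=
    ((hΦ.comp (continuous_fst.prodMk (continuous_snd.comp continuous_snd).inv)).sub
      (hΦ.comp (continuous_fst.prodMk (continuous_fst.comp continuous_snd)))).abs
  set Bad : Set (Cfg ι N × (PSU ι N × PSU ι N)) := (T ×ˢ Set.univ) ∩ Θ ⁻¹' (Set.Ici ε) with hBad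
  have hBadc : IsCompact Bad := (hT.prod isCompact_univ).inter_right (isClosed_Ici.preimage hΘc)
  set m : Cfg ι N × (PSU ι N × PSU ι N) → PSU ι N := fun z => z.2.1 * z.2.2 with hm
  have hmc : Continuous m := (continuous_fst.comp continuous_snd).mul (continuous_snd.comp continuous_snd)
  have hCc : IsClosed (m '' Bad) := (hBadc.image hmc).isClosed
  have h1 : (1 : PSU ι N) ∉ m '' Bad := by
    rintro ⟨z, hz, hz1⟩
    have hinv : z.2.2⁻¹ = z.2.1 := (eq_inv_of_mul_eq_one_left hz1).symm
    have hΘ0 : Θ z = 0 := by simp [hΘ, hinv]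
    have hz2 : ε ≤ Θ z := hz.2
    rw [hΘ0] at hz2
    exact absurd hz2 (not_le.2 hε)
  refine ⟨(m '' Bad)ᶜ, hCc.isOpen_compl, h1, fun V hV x h hxh => ?_⟩
  by_contra hlt
  exact hxh ⟨(V, (x, h)), ⟨⟨hV, Set.mem_univ _⟩, not_lt.1 hlt⟩, rfl⟩

/-! #### F. The kernel estimate -/

omit [DecidableEq ι] in
/-- **Approximate-identity estimate**: if `k ≥ 0` on the group, `∫ k = 1`, `∫_{Uᶜ} k ≤ η`, `|f| ≤ M`, and
`|f(h⁻¹) − f(x)| ≤ ε` whenever `x h ∈ U`, then `|∫ k(x h) f(h⁻¹) dh − f(x)| ≤ ε + 2 M η`. [folklore] -/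
theorem kernel_estimate {k : Cfg ι N → ℝ} (hkc : Continuous fun g : PSU ι N => k (emb g))
    (hk0 : ∀ g : PSU ι N, 0 ≤ k (emb g)) (hk1 : ∫ g, k (emb g) ∂(haarPi ι N) = 1) {U : Set (PSU ι N)}
    (hUo : IsOpen U) {η : ℝ} (hkU : ∫ g, Uᶜ.indicator (fun g => k (emb g)) g ∂(haarPi ι N) ≤ η)
    {f : PSU ι N → ℝ} (hf : Continuous f) {M ε : ℝ} (hM : ∀ g, |f g| ≤ M) (hε : 0 ≤ ε) (x : PSU ι N)
    (hU : ∀ h : PSU ι N, x * h ∈ U → |f h⁻¹ - f x| ≤ ε) :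
    |(∫ h, k (emb x * emb h) * f h⁻¹ ∂(haarPi ι N)) - f x| ≤ ε + 2 * M * η := by
  set μ := haarPi ι N
  have hM0 : 0 ≤ M := (abs_nonneg _).trans (hM 1)
  have hkxc : Continuous fun h : PSU ι N => k (emb x * emb h) := by
    simp_rw [← emb_mul]; exact hkc.comp (continuous_const.mul continuous_id)
  have hkx0 : ∀ h, 0 ≤ k (emb x * emb h) := fun h => by rw [← emb_mul]; exact hk0 _
  have hkx1 : ∫ h, k (emb x * emb h) ∂μ = 1 := by rw [integral_kernel_translate, hk1]
  have hfx : f x = ∫ h, k (emb x * emb h) * f x ∂μ := by rw [integral_mul_const, hkx1, one_mul]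
  have hint1 : Integrable (fun h => k (emb x * emb h) * f h⁻¹) μ :=
    integrable_of_continuous_PSU (hkxc.mul (hf.comp continuous_inv)) μ
  have hint2 : Integrable (fun h => k (emb x * emb h) * f x) μ :=
    integrable_of_continuous_PSU (hkxc.mul continuous_const) μ
  set tail : PSU ι N → ℝ := fun g => Uᶜ.indicator (fun g => k (emb g)) g with htail
  have htailint : Integrable tail μ :=
    (integrable_of_continuous_PSU hkc μ).indicator hUo.isClosed_compl.measurableSet
  have htailx : Integrable (fun h => tail (x * h)) μ := htailint.comp_mul_left x
  -- pointwise bound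
  have hpt : ∀ h, |k (emb x * emb h) * f h⁻¹ - k (emb x * emb h) * f x| ≤
      ε * k (emb x * emb h) + 2 * M * tail (x * h) := by
    intro h
    rw [← mul_sub, abs_mul, abs_of_nonneg (hkx0 h)]
    by_cases hxh : x * h ∈ U
    · have h1 : tail (x * h) = 0 := by
        simp only [htail]; exact Set.indicator_of_notMem (by simpa using hxh) _
      rw [h1, mul_zero, add_zero, mul_comm]
      exact mul_le_mul_of_nonneg_right (hU h hxh) (hkx0 h)
    · have h1 : tail (x * h) = k (emb x * emb h) := by
        simp only [htail]; rw [Set.indicator_of_mem (Set.mem_compl hxh), emb_mul]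
      have h2 : |f h⁻¹ - f x| ≤ 2 * M := (abs_sub _ _).trans (by linarith [hM h⁻¹, hM x])
      rw [h1]
      nlinarith [hkx0 h, h2, hε, abs_nonneg (f h⁻¹ - f x)]
  rw [hfx, ← integral_sub hint1 hint2]
  calc |∫ h, (k (emb x * emb h) * f h⁻¹ - k (emb x * emb h) * f x) ∂μ|
      ≤ ∫ h, |k (emb x * emb h) * f h⁻¹ - k (emb x * emb h) * f x| ∂μ := abs_integral_le_integral_abs
    _ ≤ ∫ h, (ε * k (emb x * emb h) + 2 * M * tail (x * h)) ∂μ :=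
        integral_mono (hint1.sub hint2).abs
          (((integrable_of_continuous_PSU hkxc μ).const_mul ε).add (htailx.const_mul (2 * M))) hpt
    _ = ε + 2 * M * ∫ h, tail (x * h) ∂μ := by
        rw [integral_add ((integrable_of_continuous_PSU hkxc μ).const_mul ε) (htailx.const_mul (2 * M)),
          integral_const_mul, integral_const_mul, hkx1, mul_one]
    _ = ε + 2 * M * ∫ h, tail h ∂μ := by rw [integral_mul_left_eq_self tail x]
    _ ≤ ε + 2 * M * η := by
        have : ∫ h, tail h ∂μ ≤ η := hkU
        nlinarith [hM0, this]

/-! #### G. Assembly: C²-approximation (sup + Hessian currency) -/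

omit [DecidableEq ι] in
/-- **D1 core — C²-Weierstrass on `SU(N)^ι` in the tree's Hessian currency**: for smooth `S` and `ε > 0` there is a
polynomial `p` with `|p − S| ≤ ε` on `SU(N)^ι` and `HessBound (p − S) (ε/2)`.  Mechanism: `p = k ⋆ S` for a polynomial
approximate identity `k` (Stone–Weierstrass + Urysohn), right-translation covariance of the convolution (left Haar
invariance) so that `D_V D_V (k ⋆ S) = k ⋆ (D_V D_V S)`, uniform continuity of `(V, y) ↦ D_V D_V S(y)` over the compact
unit directions (tube lemma), and homogeneity in `V`. [folklore] -/
theorem exists_poly_sup_hess_approx {S : Cfg ι N → ℝ} (hS : ContDiff ℝ ∞ S) {ε : ℝ} (hε : 0 < ε) :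
    ∃ (dS : ℕ) (p : Cfg ι N → ℝ), p ∈ polySpace ι N dS ∧
      (∀ x : PSU ι N, |p (emb x) - S (emb x)| ≤ ε) ∧ HessBound (p - S) (ε / 2) := by
  set μ := haarPi ι N
  set Φ₀ : Cfg ι N → PSU ι N → ℝ := fun _ g => S (emb g) with hΦ₀
  set Φ₂ : Cfg ι N → PSU ι N → ℝ := fun V g => algD V (algD V S) (emb g) with hΦ₂
  have hΦ₀c : Continuous fun p : Cfg ι N × PSU ι N => Φ₀ p.1 p.2 := (continuous_restrict hS).comp continuous_snd
  have hΦ₂c : Continuous fun p : Cfg ι N × PSU ι N => Φ₂ p.1 p.2 :=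
    (continuous_algD_algD hS).comp (continuous_fst.prodMk (continuous_emb.comp continuous_snd))
  have hT : IsCompact (dirSet ι N) := isCompact_dirSet
  obtain ⟨M₀, hM₀0, hM₀⟩ := exists_bound_uniform hT hΦ₀c
  obtain ⟨M₂, hM₂0, hM₂⟩ := exists_bound_uniform hT hΦ₂c
  obtain ⟨U₀, hU₀o, hU₀1, hU₀⟩ := exists_open_nhds_one_uniform hT hΦ₀c (half_pos hε)
  obtain ⟨U₂, hU₂o, hU₂1, hU₂⟩ := exists_open_nhds_one_uniform hT hΦ₂c (by positivity : (0 : ℝ) < ε / 4)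
  set η : ℝ := ε / (8 * (M₀ + M₂ + 1)) with hη
  have hden : 0 < M₀ + M₂ + 1 := by linarith
  have hηpos : 0 < η := by positivity
  have hq₀ : M₀ / (M₀ + M₂ + 1) ≤ 1 := by rw [div_le_one hden]; linarith
  have hq₂ : M₂ / (M₀ + M₂ + 1) ≤ 1 := by rw [div_le_one hden]; linarith
  have hη₀ : 2 * M₀ * η ≤ ε / 2 := by
    have h : 2 * M₀ * η = (ε / 4) * (M₀ / (M₀ + M₂ + 1)) := by
      rw [hη]; field_simp; ring
    rw [h]; nlinarith
  have hη₂ : 2 * M₂ * η ≤ ε / 4 := by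
    have h : 2 * M₂ * η = (ε / 4) * (M₂ / (M₀ + M₂ + 1)) := by
      rw [hη]; field_simp; ring
    rw [h]; nlinarith
  obtain ⟨n, k, hk, hk0, hk1, hkU⟩ := exists_poly_approxIdentity (hU₀o.inter hU₂o) ⟨hU₀1, hU₂1⟩ hηpos
  have hkc : Continuous fun g : PSU ι N => k (emb g) := continuous_restrict (contDiff_of_mem_polySpace hk)
  have hp : ContDiff ℝ ∞ (polyConv k S) := contDiff_of_mem_polySpace (polyConv_mem hk hS)
  have hpS : ContDiff ℝ ∞ (polyConv k S - S) := hp.sub hS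
  have h0T : (0 : Cfg ι N) ∈ dirSet ι N := ⟨fun e => by simp, fun e => by simp, by simp⟩
  refine ⟨n, polyConv k S, polyConv_mem hk hS, fun x => ?_, fun g V hV hV0 => ?_⟩
  · -- sup estimate
    have h := kernel_estimate hkc hk0 hk1 (hU₀o.inter hU₂o) hkU (continuous_restrict hS)
      (fun g => hM₀ 0 h0T g) (half_pos hε).le x (fun h hxh => (hU₀ 0 h0T x h hxh.1).le)
    rw [polyConv_apply]
    linarith
  · -- Hessian estimate: reduce to a unit direction by homogeneity
    by_cases hVz : V = 0
    · subst hVz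
      simp only [algD_zero_dir, Pi.zero_apply, abs_zero]
      positivity
    set c : ℝ := ‖V‖ with hc
    have hcpos : 0 < c := norm_pos_iff.2 hVz
    set W : Cfg ι N := c⁻¹ • V with hW
    have hWT : W ∈ dirSet ι N := by
      refine ⟨fun e => ?_, fun e => ?_, ?_⟩
      · simp only [hW, Pi.smul_apply, conjTranspose_smul, hV e, smul_neg]
        simp
      · simp only [hW, Pi.smul_apply, trace_smul, hV0 e, smul_zero]
      · rw [hW, norm_smul, norm_inv, Real.norm_eq_abs, abs_of_pos hcpos, inv_mul_cancel₀ hcpos.ne']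
    have hVW : V = c • W := by rw [hW, smul_smul, mul_inv_cancel₀ hcpos.ne', one_smul]
    have hhom : algD V (algD V (polyConv k S - S)) (emb g) = c ^ 2 * algD W (algD W (polyConv k S - S)) (emb g) := by
      rw [hVW]; exact algD_algD_smul_dir hpS c W (emb g)
    have hdiff : algD W (algD W (polyConv k S - S)) (emb g) =
        (∫ h, k (emb g * emb h) * Φ₂ W h⁻¹ ∂μ) - Φ₂ W g := by
      rw [algD_sub hp hS, algD_sub (contDiff_algD hp W) (contDiff_algD hS W), Pi.sub_apply,
        algD_algD_polyConv hk hS W hWT.1 hWT.2.1 g]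
    have hest : |algD W (algD W (polyConv k S - S)) (emb g)| ≤ ε / 4 + 2 * M₂ * η := by
      rw [hdiff]
      exact kernel_estimate hkc hk0 hk1 (hU₀o.inter hU₂o) hkU
        (continuous_restrict (contDiff_algD (contDiff_algD hS W) W)) (fun g => hM₂ W hWT g)
        (by positivity) g (fun h hxh => (hU₂ W hWT g h hxh.2).le)
    rw [hhom, abs_mul, abs_of_nonneg (sq_nonneg c)]
    calc c ^ 2 * |algD W (algD W (polyConv k S - S)) (emb g)| ≤ c ^ 2 * (ε / 2) :=
          mul_le_mul_of_nonneg_left (by linarith) (sq_nonneg _)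
      _ = (ε / 2) * ‖V‖ ^ 2 := by rw [hc]; ring
      _ ≤ (ε / 2) * ∑ e, frobNorm (V e) ^ 2 :=
          mul_le_mul_of_nonneg_left (norm_sq_le_sum_frobNorm_sq V) (by positivity)

omit [DecidableEq ι] in
/-- `HessBound` is monotone in the constant. [folklore] -/
theorem hessBound_mono {F : Cfg ι N → ℝ} {Λ Λ' : ℝ} (h : HessBound F Λ) (hΛ : Λ ≤ Λ') : HessBound F Λ' :=
  fun g V hV hV0 => (h g V hV hV0).trans (mul_le_mul_of_nonneg_right hΛ (sum_nonneg fun _ _ => sq_nonneg _))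

/-- ★★★ **D1 PROVED — C²-Weierstrass on `SU(N)^ι` in the tree's currency**: every smooth ambient function is
C²-approximable by polynomials in the tree's currency (sup on the group, `HessBound`, `OffDiagHessBound` of `p − S` all `≤ ε`) — the cell sketch's
`C2PolyApprox S`, spelled out so that this file declares no `Prop`.
In particular every real-analytic / strip-format effective action (§5) satisfies the receiver hypothesis of §4d–§6. [folklore:
group convolution with polynomial approximate identities; Stone–Weierstrass] -/
theorem c2PolyApprox_of_contDiff {S : Cfg ι N → ℝ} (hS : ContDiff ℝ ∞ S) {ε : ℝ} (hε : 0 < ε) :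
    ∃ (dS : ℕ) (p : Cfg ι N → ℝ), p ∈ polySpace ι N dS ∧ (∀ x : PSU ι N, |p (emb x) - S (emb x)| ≤ ε) ∧
      HessBound (p - S) ε ∧ OffDiagHessBound (p - S) (fun _ _ => ε) := by
  obtain ⟨dS, p, hp, hsup, hH⟩ := exists_poly_sup_hess_approx hS hε
  have hpS : ContDiff ℝ ∞ (p - S) := (contDiff_of_mem_polySpace hp).sub hS
  have hOn : ∀ (g : PSU ι N) (V : Cfg ι N), (∀ e, (V e)ᴴ = -V e) → (∀ e, (V e).trace = 0) →
      |algD V (algD V (p - S)) (emb g)| ≤ ε / 2 * ∑ e ∈ (Finset.univ : Finset ι), frobNorm (V e) ^ 2 :=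
    fun g V hV hV0 => hH g V hV hV0
  have hO := offDiagHessBound_of_hessBoundOn hpS (by positivity) hOn
  have hprof : (fun e e' : ι => if e ∈ (Finset.univ : Finset ι) ∧ e' ∈ (Finset.univ : Finset ι) then 2 * (ε / 2) else 0) =
      fun _ _ => ε := by
    funext e e'
    rw [if_pos ⟨Finset.mem_univ e, Finset.mem_univ e'⟩]
    ring
  rw [hprof] at hO
  exact ⟨dS, p, hp, hsup, hessBound_mono hH (by linarith), hO⟩

end LatticeBakryEmery

end Summit.Ventures.YMGap

end
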